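import Summits.Ventures.CertifiedManyBodySolver.Downfold.RouterScoreAggregate

/-!
# Router-word score, part 4: the cost of a FLIP under a re-route, and the R-y consequence table

Venture CertifiedManyBodySolver, cell `pub/hubbard-downfold`, seat hubbard-downfold-score-2 (session g7,
2026-08-27T03:1xZ); namespace `Summit.Ventures.CertifiedManyBodySolver.Downfold.RouterScore` (continues
`RouterScoreAggregate.lean` §2/§5, p467807 … p487392). Everything here is PROVED; nothing is about a material.

WHAT THIS IS NOT: not the scorer of record (deputy-2 `score.py` v1.8 90fa3153c4e6faab is; mirrored by
`validation/score/router/router_score.py` 172b7b4773e86f70), not a router ruling, not an A10 recommendation and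
not physics. It is the kernel reference for ONE ledger entry written BEFORE the event it scores:
`validation/score/PREREG.md` **Y62** — the downfold lead's RULING R-y (2026-08-27T02:50:41Z: admit the cell's own
screening-grade cRPA(W)@PBE one-band U into the La-214 hull) makes run-7's mechanical re-route (03:08:37Z) PRINT
«UND:MIXED+1BH+3BE+EPH» on the six LSCO-family calibration columns M13–M17/M50, i.e. six cells of record would
move AGREE → PARTIAL the minute those words become the words of record (ROUTER §7(3) re-route ⇒ PREREG D2: a
second score row per cell, the latest stands).

* `rPass_flip_iff` — moving `n` cells from AGREE to a decided non-AGREE outcome keeps the rung-1 clause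
  «R ≥ 0.90» (`rPass`, cleared of fractions) iff `9·k + 10·n ≤ a`: a flip costs TEN cells of slack, one more
  than a fresh non-AGREE cell (`rPass_succ_iff`).
* `ry_calibration_ledger` — the calibration ledger 44/4 has slack 8 < 10 and tolerates no flip.
* `ry_consequence_rPass` — the map-level table: (γ) 38/7 → 32/13 FAIL; (α) 39/6 FAIL (40/5 before R-y, FAIL);
  (β) 41/4 PASS (42/3 before, PASS): R-y does not change WHICH treatment clears the clause on today's words.
  Whether (α)/(β) is ever adopted is decided blind on the twelve Y37 hold-out cells (`recommend`,
  `RouterScoreAggregate` §3), never on this table — the guard registered with Y62.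
-/

namespace Summit.Ventures.CertifiedManyBodySolver.Downfold

namespace RouterScore

/-- THE PRICE OF A FLIP: moving `n` cells from AGREE to a decided non-AGREE outcome (a re-route under an
amendment) leaves the clause true iff `9·k + 10·n ≤ a` — each flipped cell costs ten. [folklore] -/
theorem rPass_flip_iff (a k n : ℕ) (h : n ≤ a) :
    rPass (a - n) (k + n) = true ↔ 9 * k + 10 * n ≤ a := by
  rw [rPass_iff]; omega

/-- hence a passing tally with fewer than ten cells of slack (`a < 9k + 10`) tolerates no flip at all.
[folklore] -/
theorem rPass_flip_false_of_lt (a k n : ℕ) (h : n ≤ a) (hn : 0 < n) (hslack : a < 9 * k + 10) :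
    rPass (a - n) (k + n) = false := by
  have key : ¬ (rPass (a - n) (k + n) = true) := by
    rw [rPass_flip_iff a k n h]; omega
  simpa using key

/-- conversely, flipping cells BACK (a decided non-AGREE cell re-routed to AGREE; truncated subtraction, so
any `n`) keeps a passing clause passing — the direction an adopted A10 treatment moves cells under
no-regression. [folklore] -/
theorem rPass_unflip (a k n : ℕ) (hR : rPass a k = true) : rPass (a + n) (k - n) = true :=
  rPass_mono (Nat.le_add_right a n) (Nat.sub_le k n) hR

/-- THE CALIBRATION LEDGER under R-y (ROUTER-SCORES.tsv, 2026-08-27T03:1xZ): 44 AGREE / 4 PARTIAL passes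
«R ≥ 0.90» with slack 44 − 36 = 8 < 10, so it tolerates NO flip: a single one (43/5) already fails, and the
six LSCO-family flips R-y would print leave 38/10. [folklore] -/
theorem ry_calibration_ledger :
    rPass 44 4 = true ∧ rPass (44 - 1) (4 + 1) = false ∧ rPass (44 - 6) (4 + 6) = false := by
  decide

/-- THE R-y CONSEQUENCE TABLE in integers (PREREG Y62; 45 worded v1 materials at map level, RUN #8–#10 of
record 38/7): today (γ) FAILS «R ≥ 0.90»; with the six La-214 flips (γ) reads 32/13 and fails by more;
re-routing everything under (α) would read 39/6 — FAIL (before R-y 40/5, also FAIL); under (β) 41/4 — PASS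
(before R-y 42/3, PASS). [folklore] -/
theorem ry_consequence_rPass :
    rPass 38 7 = false ∧ rPass 32 13 = false ∧
      rPass 39 6 = false ∧ rPass 40 5 = false ∧
      rPass 41 4 = true ∧ rPass 42 3 = true := by
  decide

/-- the distance to the floor in cells: with 45 decided materials at most four may be non-AGREE
(41/4 passes, 40/5 fails); from (γ)-after-R-y 32/13 that is nine materials away. [folklore] -/
theorem ry_floor_distance : rPass 41 4 = true ∧ rPass 40 5 = false ∧ 41 - 32 = 9 := by
  decide

end RouterScore

end Summit.Ventures.CertifiedManyBodySolver.Downfold
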